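import Mathlib
import Summits.NavierStokesRegularity.NavierStokesRegularity.Theorems.ThreadingFluxCentreJetDefs
import Summits.NavierStokesRegularity.NavierStokesRegularity.Theorems.ThreadingFluxCentreJetDriftLaw
import Summits.NavierStokesRegularity.NavierStokesRegularity.Theorems.ThreadingFluxCentreJetDriftLawEvolution
import Summits.NavierStokesRegularity.NavierStokesRegularity.Theorems.ThreadingFluxCentreJetSteadySlaving
import HarnessLib

/-!
# Crux `PoloidalLiouville` (stmt-NavierStokesRegularity-1222, wall W1), crux idea «steady-centre-sieve» (ns-idea-15 g5):
# `CentreDriftLaw` (E2), `CentreDriftLawEvolution` (E2′) and `SteadySlavingIdentity` (E5) of `ThreadingFluxCentreJetDefs.lean` BY NAME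

Support file (Theorems-side glue; seat ns-wall-eng-7 g4, cell ns-wall-extremal, W1 adjunct; `--supports
stmt-NavierStokesRegularity-1222 --as helper`).  One-line η-wrappers of the verbatim-body kernel theorems over the (appended)
Theorems-side Defs twin: `centreDriftLaw_holds : CentreDriftLaw`, `centreDriftLawEvolution_holds : CentreDriftLawEvolution`,
`steadySlavingIdentity_holds : SteadySlavingIdentity` (`IsSteadyNSOn` / `IsUnthreadedAbout` unfold by `rfl`).  Companion of
`ThreadingFluxCentreJetByName.lean` (E1, E3, R3, sanity).

HONEST LABEL: information-grade S-lemmas of an idea card; the card's conjectures and target, `PoloidalLiouville` (1222) and NS regularity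
remain OPEN and untouched.  [cite: MajdaBertozziCUP2002, §1.1 (vector identities)]
-/

-- the summit and its single problem share the name (D-0017 nested layout)
set_option linter.dupNamespace false

noncomputable section

namespace Summit.NavierStokesRegularity.NavierStokesRegularity.Theorems.PoloidalLiouville.CentreJet

/-- ★ **(E2) `CentreDriftLaw` BY NAME.** -/
theorem centreDriftLaw_holds : CentreDriftLaw :=
  fun V p x₀ hNS hun => centreDriftLaw V p x₀ hNS hun

/-- ★ **(E2′) `CentreDriftLawEvolution` BY NAME.** -/
theorem centreDriftLawEvolution_holds : CentreDriftLawEvolution :=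
  fun u p x₀ t₀ t₁ ht hsol hun t htS => centreDriftLawEvolution u p x₀ t₀ t₁ ht hsol hun t htS

/-- ★ **(E5) `SteadySlavingIdentity` BY NAME.** -/
theorem steadySlavingIdentity_holds : SteadySlavingIdentity :=
  fun V p T x₀ hNS hV hT hcurl x hx => steadySlavingIdentity V p T x₀ hNS hV hT hcurl x hx

end Summit.NavierStokesRegularity.NavierStokesRegularity.Theorems.PoloidalLiouville.CentreJet

end
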